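import Mathlib
import Summits.RiemannHypothesis.RiemannHypothesis.Theorems.WeilFarFloorCouplingTransfer
import Summits.RiemannHypothesis.RiemannHypothesis.Theorems.WeilFarFloorCoshSplitRH
import HarnessLib

/-!
# The cosh residual: evenness, size, and small-scale modulus (RH-free)

Helper file (`--supports stmt-RiemannHypothesis-0098`, lead-track anchor: Weil-positivity window ladder, format-C far bound),
pure proofs.  Seat rh-explicit-weil-1 gen15 (memo `run/shared/lean/pub/rh-explicit/rh-explicit-weil-1/FORMAT-K3.md` §16.4): the
RH-free facts about the second direction of the floor gap needed by the LOWER half of the second-order law.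

`C = C_a = 1_{[−a,a]}cosh(·/2)`, `F = T_aC` (prime-shift operator, `A = Σ_{log n<2a} Λ(n)/√n`), `R = R_c(a) = Q_a(C)/(a + sinh a)`,
`G = F − R·C`, and the truncated residuals `r_c = 1_{[−c,c]}·G` (`c ≤ a`; `c = a` is the residual `r` of `WeilFarFloorSecondOrderLower`).

* §1 evenness: `C(−x) = C(x)`, `F(−x) = F(x)`, `r_c(−x) = r_c(x)`, hence `∫ r_c(x) sinh(x/2) dx = 0`;
* §2 size: `|G| ≤ (2A + |R|)cosh(a/2)`, `r_c` admissible;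
* §3 increments: `D_y(F) ≤ 4A²·D_y(C)` (`WeilFarFloorCouplingTransfer.integral_primeShiftOp_sq_le` applied to `C(·+y) − C`),
  `D_y(G) ≤ 8A²D_y(C) + 2R²D_y(C)`, and for the truncation `D_y(1_{[−c,c]}G) ≤ 2D_y(G) + 4|y|·sup|G|²`; with
  `D_y(C) ≤ (a + sinh a + 3)|y|` (`coshTest_modulus_le`): **`D_y(r_c) ≤ M_lin·|y|`** for `|y| ≤ 1`,
  `M_lin = (16A² + 4R²)(a + sinh a + 3) + 4(2A + |R|)²cosh²(a/2)`;
* §4 the window identities `∫_{(−a,a)} C·G = 0`, `∫_{(−a,a)} F·G = ∫_{(−a,a)} G²` (projection; `∫(T_aC)C = Q_a(C)`).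
Standard axioms only.
-/

set_option linter.dupNamespace false
set_option autoImplicit false

noncomputable section

open MeasureTheory Set Filter
open scoped Real Topology ArithmeticFunction.vonMangoldt

namespace Summit.RiemannHypothesis.RiemannHypothesis.Theorems.WeilFormatC

namespace FloorSecondOrder

open Literature.NumberTheory.LFunctions FloorCosh FloorCoshSplit

variable {a : ℝ}

/-! ## §1 Evenness -/

/-- The cosh profile is even. -/
theorem coshTest_neg (a x : ℝ) :
    (Icc (-a) a).indicator (fun y ↦ Real.cosh (y / 2)) (-x) = (Icc (-a) a).indicator (fun y ↦ Real.cosh (y / 2)) x := by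
  by_cases hx : x ∈ Icc (-a) a
  · have hx' : -x ∈ Icc (-a) a := ⟨by linarith [hx.2], by linarith [hx.1]⟩
    rw [indicator_of_mem hx, indicator_of_mem hx', neg_div, Real.cosh_neg]
  · have hx' : -x ∉ Icc (-a) a := fun h ↦ hx ⟨by linarith [h.2], by linarith [h.1]⟩
    rw [indicator_of_notMem hx, indicator_of_notMem hx']

/-- The prime-shift operator preserves evenness: `T_aC(−x) = T_aC(x)` for the cosh profile. -/
theorem primeShiftOp_coshTest_neg (a x : ℝ) :
    (∑ n ∈ weilPrimeIndex a, (Λ n : ℝ) / Real.sqrt n *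
        ((Icc (-a) a).indicator (fun y ↦ Real.cosh (y / 2)) (-x - Real.log n)
          + (Icc (-a) a).indicator (fun y ↦ Real.cosh (y / 2)) (-x + Real.log n)))
      = ∑ n ∈ weilPrimeIndex a, (Λ n : ℝ) / Real.sqrt n *
        ((Icc (-a) a).indicator (fun y ↦ Real.cosh (y / 2)) (x - Real.log n)
          + (Icc (-a) a).indicator (fun y ↦ Real.cosh (y / 2)) (x + Real.log n)) := by
  refine Finset.sum_congr rfl fun n _ ↦ ?_
  rw [show -x - Real.log n = -(x + Real.log n) by ring, show -x + Real.log n = -(x - Real.log n) by ring,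
    coshTest_neg, coshTest_neg, add_comm]

/-- The truncated residual `r_c = 1_{[−c,c]}(T_aC − R·C)` is even. -/
theorem residual_neg (a c R x : ℝ) :
    (Icc (-c) c).indicator (fun x ↦
        (∑ n ∈ weilPrimeIndex a, (Λ n : ℝ) / Real.sqrt n *
          ((Icc (-a) a).indicator (fun y ↦ Real.cosh (y / 2)) (x - Real.log n)
            + (Icc (-a) a).indicator (fun y ↦ Real.cosh (y / 2)) (x + Real.log n)))
        - R * (Icc (-a) a).indicator (fun y ↦ Real.cosh (y / 2)) x) (-x)
      = (Icc (-c) c).indicator (fun x ↦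
        (∑ n ∈ weilPrimeIndex a, (Λ n : ℝ) / Real.sqrt n *
          ((Icc (-a) a).indicator (fun y ↦ Real.cosh (y / 2)) (x - Real.log n)
            + (Icc (-a) a).indicator (fun y ↦ Real.cosh (y / 2)) (x + Real.log n)))
        - R * (Icc (-a) a).indicator (fun y ↦ Real.cosh (y / 2)) x) x := by
  by_cases hx : x ∈ Icc (-c) c
  · have hx' : -x ∈ Icc (-c) c := ⟨by linarith [hx.2], by linarith [hx.1]⟩
    rw [indicator_of_mem hx, indicator_of_mem hx', primeShiftOp_coshTest_neg, coshTest_neg]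
  · have hx' : -x ∉ Icc (-c) c := fun h ↦ hx ⟨by linarith [h.2], by linarith [h.1]⟩
    rw [indicator_of_notMem hx, indicator_of_notMem hx']

/-- An even function is orthogonal to `sinh(·/2)`: `∫ f(x) sinh(x/2) dx = 0` when `f(−x) = f(x)`. -/
theorem integral_mul_sinh_half_eq_zero_of_even {f : ℝ → ℝ} (hf : ∀ x, f (-x) = f x) :
    ∫ x, f x * Real.sinh (x / 2) = 0 := by
  have h := integral_neg_eq_self (μ := (volume : Measure ℝ)) (fun x ↦ f x * Real.sinh (x / 2))
  have e : (fun x ↦ f (-x) * Real.sinh (-x / 2)) = fun x ↦ -(f x * Real.sinh (x / 2)) := by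
    funext x; rw [hf, neg_div, Real.sinh_neg]; ring
  simp only [e, integral_neg] at h
  linarith

/-! ## §2 Size and admissibility -/

/-- `|T_aC(x) − R·C(x)| ≤ (2A + |R|)cosh(a/2)`. -/
theorem abs_residualCore_le (a R x : ℝ) :
    |(∑ n ∈ weilPrimeIndex a, (Λ n : ℝ) / Real.sqrt n *
          ((Icc (-a) a).indicator (fun y ↦ Real.cosh (y / 2)) (x - Real.log n)
            + (Icc (-a) a).indicator (fun y ↦ Real.cosh (y / 2)) (x + Real.log n)))
        - R * (Icc (-a) a).indicator (fun y ↦ Real.cosh (y / 2)) x|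
      ≤ (2 * (∑ n ∈ weilPrimeIndex a, (Λ n : ℝ) / Real.sqrt n) + |R|) * Real.cosh (a / 2) := by
  obtain ⟨-, hCb, -⟩ := coshTest_admissible a
  refine (abs_sub _ _).trans ?_
  rw [add_mul, abs_mul]
  exact add_le_add (abs_primeShiftOp_le hCb x) (mul_le_mul_of_nonneg_left (hCb x) (abs_nonneg _))

/-- The truncated residual `r_c` (`c ≤ a`) is admissible on `[−a, a]`: measurable, bounded by `(2A + |R|)cosh(a/2)`,
vanishing off `[−c, c]` (hence off `[−a, a]`). -/
theorem residual_trunc_admissible {c : ℝ} (hca : c ≤ a) (R : ℝ) :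
    Measurable ((Icc (-c) c).indicator fun x ↦
        (∑ n ∈ weilPrimeIndex a, (Λ n : ℝ) / Real.sqrt n *
          ((Icc (-a) a).indicator (fun y ↦ Real.cosh (y / 2)) (x - Real.log n)
            + (Icc (-a) a).indicator (fun y ↦ Real.cosh (y / 2)) (x + Real.log n)))
        - R * (Icc (-a) a).indicator (fun y ↦ Real.cosh (y / 2)) x)
    ∧ (∀ x, |(Icc (-c) c).indicator (fun x ↦
        (∑ n ∈ weilPrimeIndex a, (Λ n : ℝ) / Real.sqrt n *
          ((Icc (-a) a).indicator (fun y ↦ Real.cosh (y / 2)) (x - Real.log n)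
            + (Icc (-a) a).indicator (fun y ↦ Real.cosh (y / 2)) (x + Real.log n)))
        - R * (Icc (-a) a).indicator (fun y ↦ Real.cosh (y / 2)) x) x|
        ≤ (2 * (∑ n ∈ weilPrimeIndex a, (Λ n : ℝ) / Real.sqrt n) + |R|) * Real.cosh (a / 2))
    ∧ (∀ x, x ∉ Icc (-c) c → (Icc (-c) c).indicator (fun x ↦
        (∑ n ∈ weilPrimeIndex a, (Λ n : ℝ) / Real.sqrt n *
          ((Icc (-a) a).indicator (fun y ↦ Real.cosh (y / 2)) (x - Real.log n)
            + (Icc (-a) a).indicator (fun y ↦ Real.cosh (y / 2)) (x + Real.log n)))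
        - R * (Icc (-a) a).indicator (fun y ↦ Real.cosh (y / 2)) x) x = 0)
    ∧ (∀ x, x ∉ Icc (-a) a → (Icc (-c) c).indicator (fun x ↦
        (∑ n ∈ weilPrimeIndex a, (Λ n : ℝ) / Real.sqrt n *
          ((Icc (-a) a).indicator (fun y ↦ Real.cosh (y / 2)) (x - Real.log n)
            + (Icc (-a) a).indicator (fun y ↦ Real.cosh (y / 2)) (x + Real.log n)))
        - R * (Icc (-a) a).indicator (fun y ↦ Real.cosh (y / 2)) x) x = 0) := by
  obtain ⟨hCm, hCb, hCs⟩ := coshTest_admissible a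
  have hA : 0 ≤ (2 * (∑ n ∈ weilPrimeIndex a, (Λ n : ℝ) / Real.sqrt n) + |R|) * Real.cosh (a / 2) := by
    have : 0 ≤ ∑ n ∈ weilPrimeIndex a, (Λ n : ℝ) / Real.sqrt n :=
      Finset.sum_nonneg fun n _ ↦ div_nonneg ArithmeticFunction.vonMangoldt_nonneg (Real.sqrt_nonneg _)
    have := (Real.cosh_pos (a / 2)).le
    positivity
  have hs : ∀ x, x ∉ Icc (-c) c → (Icc (-c) c).indicator (fun x ↦
      (∑ n ∈ weilPrimeIndex a, (Λ n : ℝ) / Real.sqrt n *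
        ((Icc (-a) a).indicator (fun y ↦ Real.cosh (y / 2)) (x - Real.log n)
          + (Icc (-a) a).indicator (fun y ↦ Real.cosh (y / 2)) (x + Real.log n)))
      - R * (Icc (-a) a).indicator (fun y ↦ Real.cosh (y / 2)) x) x = 0 := fun x hx ↦ indicator_of_notMem hx _
  refine ⟨((measurable_primeShiftOp hCm).sub (hCm.const_mul R)).indicator measurableSet_Icc, fun x ↦ ?_, hs,
    fun x hx ↦ hs x fun h ↦ hx ⟨by linarith [h.1], by linarith [h.2]⟩⟩
  by_cases hx : x ∈ Icc (-c) c
  · rw [indicator_of_mem hx]; exact abs_residualCore_le a R x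
  · rw [indicator_of_notMem hx, abs_zero]; exact hA

/-! ## §3 Increments -/

/-- **Increments of `T_aC`**: `∫ (T_aC(x+y) − T_aC(x))² ≤ 4A²·∫ (C(x+y) − C(x))²` (the operator applied to the increment of `C`). -/
theorem integral_sq_primeShiftOp_coshTest_shift_sub_le (a y : ℝ) :
    ∫ x, ((∑ n ∈ weilPrimeIndex a, (Λ n : ℝ) / Real.sqrt n *
          ((Icc (-a) a).indicator (fun z ↦ Real.cosh (z / 2)) (x + y - Real.log n)
            + (Icc (-a) a).indicator (fun z ↦ Real.cosh (z / 2)) (x + y + Real.log n)))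
        - (∑ n ∈ weilPrimeIndex a, (Λ n : ℝ) / Real.sqrt n *
          ((Icc (-a) a).indicator (fun z ↦ Real.cosh (z / 2)) (x - Real.log n)
            + (Icc (-a) a).indicator (fun z ↦ Real.cosh (z / 2)) (x + Real.log n)))) ^ 2
      ≤ 4 * (∑ n ∈ weilPrimeIndex a, (Λ n : ℝ) / Real.sqrt n) ^ 2
        * ∫ x, ((Icc (-a) a).indicator (fun z ↦ Real.cosh (z / 2)) (x + y)
            - (Icc (-a) a).indicator (fun z ↦ Real.cosh (z / 2)) x) ^ 2 := by
  obtain ⟨hCm, hCb, hCs⟩ := coshTest_admissible a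
  set C : ℝ → ℝ := (Icc (-a) a).indicator (fun z ↦ Real.cosh (z / 2)) with hC
  -- the increment `Δ(x) = C(x+y) − C(x)` is admissible on `[−(a+|y|), a+|y|]`
  set Δ : ℝ → ℝ := fun x ↦ C (x + y) - C x with hΔ
  have hΔm : Measurable Δ := (hCm.comp (measurable_id.add_const y)).sub hCm
  have hΔb : ∀ x, |Δ x| ≤ Real.cosh (a / 2) + Real.cosh (a / 2) := fun x ↦
    (abs_sub _ _).trans (add_le_add (hCb _) (hCb _))
  have hΔs : ∀ x, x ∉ Icc (-(a + |y|)) (a + |y|) → Δ x = 0 := by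
    intro x hx
    have h1 : x ∉ Icc (-a) a := fun h ↦ hx ⟨by linarith [h.1, abs_nonneg y], by linarith [h.2, abs_nonneg y]⟩
    have h2 : x + y ∉ Icc (-a) a := fun h ↦ hx ⟨by linarith [h.1, le_abs_self y, neg_abs_le y],
      by linarith [h.2, le_abs_self y, neg_abs_le y]⟩
    simp only [hΔ, hCs _ h1, hCs _ h2, sub_zero]
  have h := integral_primeShiftOp_sq_le (b' := a) hΔm hΔb hΔs
  have e : ∀ x, (∑ n ∈ weilPrimeIndex a, (Λ n : ℝ) / Real.sqrt n * (C (x + y - Real.log n) + C (x + y + Real.log n)))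
      - (∑ n ∈ weilPrimeIndex a, (Λ n : ℝ) / Real.sqrt n * (C (x - Real.log n) + C (x + Real.log n)))
      = ∑ n ∈ weilPrimeIndex a, (Λ n : ℝ) / Real.sqrt n * (Δ (x - Real.log n) + Δ (x + Real.log n)) := by
    intro x
    rw [← Finset.sum_sub_distrib]
    refine Finset.sum_congr rfl fun n _ ↦ ?_
    simp only [hΔ]
    rw [show x - Real.log n + y = x + y - Real.log n by ring, show x + Real.log n + y = x + y + Real.log n by ring]
    ring
  simp only [e]
  exact h

/-- `∫ (f(x+y) + g(x+y) − (f x + g x))²`-type splitting: `D_y(p + q) ≤ 2D_y(p) + 2D_y(q)` for admissible `p, q`. -/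
theorem integral_sq_shift_sub_add_le {p q : ℝ → ℝ} {Cp Cq B : ℝ} (hp : Measurable p) (hq : Measurable q)
    (hCp : ∀ x, |p x| ≤ Cp) (hCq : ∀ x, |q x| ≤ Cq) (hps : ∀ x, x ∉ Icc (-B) B → p x = 0)
    (hqs : ∀ x, x ∉ Icc (-B) B → q x = 0) (y : ℝ) :
    ∫ x, ((p (x + y) + q (x + y)) - (p x + q x)) ^ 2
      ≤ 2 * (∫ x, (p (x + y) - p x) ^ 2) + 2 * ∫ x, (q (x + y) - q x) ^ 2 := by
  have ip := integrable_sq_shiftAdd_sub hp hCp hps y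
  have iq := integrable_sq_shiftAdd_sub hq hCq hqs y
  rw [← integral_const_mul, ← integral_const_mul, ← integral_add (ip.const_mul 2) (iq.const_mul 2)]
  refine integral_mono_of_nonneg (Eventually.of_forall fun x ↦ sq_nonneg _) ((ip.const_mul 2).add (iq.const_mul 2))
    (Eventually.of_forall fun x ↦ ?_)
  nlinarith [sq_nonneg ((p (x + y) - p x) - (q (x + y) - q x))]

/-- **Truncation adds a boundary term**: for an admissible `G` with `|G| ≤ M₀` and `c ≥ 0`, `|y| ≤ 1`:
`D_y(1_{[−c,c]}·G) ≤ 2D_y(G) + 4M₀²·|y|`. -/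
theorem integral_sq_shift_sub_indicator_mul_le {G : ℝ → ℝ} {M₀ B c : ℝ} (hG : Measurable G) (hGb : ∀ x, |G x| ≤ M₀)
    (hGs : ∀ x, x ∉ Icc (-B) B → G x = 0) (y : ℝ) :
    ∫ x, ((Icc (-c) c).indicator G (x + y) - (Icc (-c) c).indicator G x) ^ 2
      ≤ 2 * (∫ x, (G (x + y) - G x) ^ 2) + 4 * M₀ ^ 2 * |y| := by
  have hM₀ : 0 ≤ M₀ := (abs_nonneg _).trans (hGb 0)
  set χG : ℝ → ℝ := (Icc (-c) c).indicator G with hχG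
  have hχm : Measurable χG := hG.indicator measurableSet_Icc
  have hχb : ∀ x, |χG x| ≤ M₀ := fun x ↦ by
    by_cases hx : x ∈ Icc (-c) c
    · rw [hχG, indicator_of_mem hx]; exact hGb x
    · rw [hχG, indicator_of_notMem hx, abs_zero]; exact hM₀
  have hχs : ∀ x, x ∉ Icc (-c) c → χG x = 0 := fun x hx ↦ indicator_of_notMem hx _
  have iχ := integrable_sq_shiftAdd_sub hχm hχb hχs y
  have iG := integrable_sq_shiftAdd_sub hG hGb hGs y
  -- the symmetric difference of the window and its shift
  set S : Set ℝ := Icc (-c - |y|) (-c + |y|) ∪ Icc (c - |y|) (c + |y|) with hS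
  have hSm : MeasurableSet S := measurableSet_Icc.union measurableSet_Icc
  have hSvol : volume.real S ≤ 4 * |y| := by
    calc volume.real S ≤ volume.real (Icc (-c - |y|) (-c + |y|)) + volume.real (Icc (c - |y|) (c + |y|)) :=
          measureReal_union_le _ _
      _ = 4 * |y| := by
          rw [Real.volume_real_Icc_of_le (by linarith [abs_nonneg y]), Real.volume_real_Icc_of_le (by linarith [abs_nonneg y])]
          ring
  have iS : Integrable (S.indicator fun _ ↦ (M₀ ^ 2 : ℝ)) :=
    (integrable_indicator_iff hSm).2 (integrableOn_const
      ((measure_union_le _ _).trans_lt (ENNReal.add_lt_top.2 ⟨measure_Icc_lt_top, measure_Icc_lt_top⟩)).ne)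
  have hI0 : ∀ x, 0 ≤ S.indicator (fun _ ↦ (M₀ ^ 2 : ℝ)) x := fun x ↦ by
    by_cases hx : x ∈ S
    · rw [indicator_of_mem hx]; positivity
    · rw [indicator_of_notMem hx]
  have hy1 := le_abs_self y
  have hy2 := neg_abs_le y
  -- pointwise: `(Δχ)² ≤ 2(ΔG)² + 1_S·M₀²`
  have hpt : ∀ x, (χG (x + y) - χG x) ^ 2 ≤ 2 * (G (x + y) - G x) ^ 2 + S.indicator (fun _ ↦ (M₀ ^ 2 : ℝ)) x := by
    intro x
    by_cases h1 : x ∈ Icc (-c) c <;> by_cases h2 : x + y ∈ Icc (-c) c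
    · rw [hχG, indicator_of_mem h1, indicator_of_mem h2]
      nlinarith [sq_nonneg (G (x + y) - G x), hI0 x]
    · -- `x ∈ window`, `x + y ∉ window` ⇒ `x ∈ S`
      have hxS : x ∈ S := by
        rw [hS, mem_union, mem_Icc, mem_Icc]
        by_cases hlt : x + y < -c
        · left; constructor <;> linarith [h1.1, h1.2]
        · right
          have hgt : c < x + y := by
            by_contra hle
            exact h2 ⟨le_of_not_gt hlt, le_of_not_gt hle⟩
          constructor <;> linarith [h1.1, h1.2]
      rw [hχG, indicator_of_mem h1, indicator_of_notMem h2, indicator_of_mem hxS]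
      have := hGb x
      rw [abs_le] at this
      nlinarith [sq_nonneg (G (x + y) - G x), this.1, this.2]
    · have hxS : x ∈ S := by
        rw [hS, mem_union, mem_Icc, mem_Icc]
        by_cases hlt : x < -c
        · left; constructor <;> linarith [h2.1, h2.2]
        · right
          have hgt : c < x := by
            by_contra hle
            exact h1 ⟨le_of_not_gt hlt, le_of_not_gt hle⟩
          constructor <;> linarith [h2.1, h2.2]
      rw [hχG, indicator_of_notMem h1, indicator_of_mem h2, indicator_of_mem hxS]
      have := hGb (x + y)
      rw [abs_le] at this
      nlinarith [sq_nonneg (G (x + y) - G x), this.1, this.2]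
    · rw [hχG, indicator_of_notMem h1, indicator_of_notMem h2]
      nlinarith [sq_nonneg (G (x + y) - G x), hI0 x]
  calc ∫ x, (χG (x + y) - χG x) ^ 2
      ≤ ∫ x, (2 * (G (x + y) - G x) ^ 2 + S.indicator (fun _ ↦ (M₀ ^ 2 : ℝ)) x) :=
        integral_mono_of_nonneg (Eventually.of_forall fun x ↦ sq_nonneg _) ((iG.const_mul 2).add iS)
          (Eventually.of_forall hpt)
    _ = 2 * (∫ x, (G (x + y) - G x) ^ 2) + M₀ ^ 2 * volume.real S := by
        rw [integral_add (iG.const_mul 2) iS, integral_const_mul, integral_indicator hSm, setIntegral_const, smul_eq_mul,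
          mul_comm (volume.real S)]
    _ ≤ 2 * (∫ x, (G (x + y) - G x) ^ 2) + 4 * M₀ ^ 2 * |y| := by nlinarith [hSvol, sq_nonneg M₀]

end FloorSecondOrder

end Summit.RiemannHypothesis.RiemannHypothesis.Theorems.WeilFormatC
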